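import Mathlib.MeasureTheory.Integral.Layercake
import Mathlib.Analysis.SpecialFunctions.ImproperIntegrals

/-!
# Stub `stub_smallBallLayerCake` (D4) of line `determinant-tilt`
(crux `Summit.QuantumFields.QCD.Theses.SpectralDefectExtinction.ExtinctionBuildsQCD`, item stmt-QuantumFields-18064)

HÖLDER SMALL BALL ⇒ FRACTIONAL MOMENT, abstract form.  For a finite measure `μ`, a measurable `X ≥ 0` (read: the
coercivity level of a ball, whose least-squares local inverse has norm `1/X`), a scale `w > 0`, `θ ∈ (0,1]`,
exponents `0 < s < α`, a constant `K ≥ 0` and the small-ball bound `μ{X < τ} ≤ K (τ/w)^α` for all `0 < τ ≤ θw`: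

  `∫⁻_{X < θw} (X⁻¹)^s dμ ≤ K θ^α (α/(α−s)) ((θw)⁻¹)^s`.

Proof (layer cake, Mathlib `MeasureTheory.lintegral_eq_lintegral_meas_lt` on `μ|{X < θw}`): with `T := ((θw)⁻¹)^s`,
`∫_{X<θw} (X⁻¹)^s dμ = ∫₀^∞ μ{X < θw, (X⁻¹)^s > t} dt`; on `t ≤ T` the measure is `≤ μ{X < θw} ≤ K θ^α`
(the hypothesis at `τ = θw`), on `t > T` one has `{(X⁻¹)^s > t} ⊆ {X < t^{-1/s}}` with `t^{-1/s} < θw`, so the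
measure is `≤ K w^{-α} t^{-α/s}`; finally `∫_T^∞ t^{-α/s} dt = T^{1-α/s} s/(α−s)` (`integral_Ioi_rpow_of_lt`) and
`T^{1−α/s} = T (θw)^α`, giving `K θ^α T (1 + s/(α−s)) = K θ^α (α/(α−s)) T`.  The constant is sharp (equality when
`μ{X < τ} = K (τ/w)^α` on `[0, θw]`).  At `X ω = 0` Lean's `(0⁻¹)^s = 0` only lowers the left side.

The layer-cake idiom is adapted from `Literature/MeasureTheory/Integral/SmallBallNegativeMoments.lean`
(`lintegral_rpow_neg_mul_le_of_smallBalls`); Mathlib only, no named facts are used.  Aizenman–Schenker–Friedrich–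
Hundertmark, Comm. Math. Phys. 224 (2001) 219, App. A use this step in the fractional-moment method. [folklore]
-/

noncomputable section

namespace Summit.QuantumFields.QCD.Cruxes.ExtinctionBuildsQCD.DeterminantTilt

open scoped BigOperators ENNReal
open Filter MeasureTheory Set

/-- **Stub D4 (`stub_smallBallLayerCake`) — Hölder small ball ⇒ fractional moment (abstract layer cake).**
For a finite measure `μ`, a measurable `X ≥ 0`, a scale `w > 0`, `θ ∈ (0,1]`, exponents `0 < s < α` and `K ≥ 0`
with the small-ball bound `μ{X < τ} ≤ K (τ/w)^α` for all `0 < τ ≤ θw`: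
`∫⁻_{X < θw} (X⁻¹)^s dμ ≤ K θ^α (α/(α−s)) ((θw)⁻¹)^s`.  Layer cake: split the level integral
`∫₀^∞ μ{X < θw, (X⁻¹)^s > t} dt` at `T = ((θw)⁻¹)^s`, bound the measure by `K θ^α` below `T` and by the small
ball at `τ = t^{-1/s}` above `T`, and integrate `t^{-α/s}` over `(T, ∞)`. [folklore] -/
theorem stub_smallBallLayerCake :
    ∀ {Ω : Type} [MeasurableSpace Ω] (μ : Measure Ω) [IsFiniteMeasure μ] (X : Ω → ℝ), Measurable X → (∀ ω, 0 ≤ X ω) →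
      ∀ (w θ α s K : ℝ), 0 < w → 0 < θ → θ ≤ 1 → 0 < s → s < α → 0 ≤ K →
      (∀ τ : ℝ, 0 < τ → τ ≤ θ * w → μ {ω | X ω < τ} ≤ ENNReal.ofReal (K * (τ / w) ^ α)) →
      ∫⁻ ω in {ω | X ω < θ * w}, ENNReal.ofReal ((X ω)⁻¹ ^ s) ∂μ ≤
        ENNReal.ofReal (K * θ ^ α * (α / (α - s)) * (θ * w)⁻¹ ^ s) := by
  intro Ω _ μ _ X hXm hX0 w θ α s K hw hθ _ hs hsα hK hSB
  have hc : 0 < θ * w := mul_pos hθ hw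
  have hαs : 0 < α - s := sub_pos.2 hsα
  have hs0 : s ≠ 0 := hs.ne'
  -- pass to the restricted measure and apply the layer-cake formula to `ω ↦ (X ω)⁻¹ ^ s`
  set ν : Measure Ω := μ.restrict {ω | X ω < θ * w} with hν
  have hfm : Measurable fun ω => (X ω)⁻¹ ^ s := hXm.inv.pow_const s
  rw [lintegral_eq_lintegral_meas_lt ν (ae_of_all _ fun ω => Real.rpow_nonneg (inv_nonneg.2 (hX0 ω)) s)
    hfm.aemeasurable]
  -- the threshold level `T = ((θw)⁻¹)^s`
  set T : ℝ := (θ * w)⁻¹ ^ s with hT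
  have hT0 : 0 < T := Real.rpow_pos_of_pos (inv_pos.2 hc) s
  -- the trivial bound at every level: `ν ≤ μ{X < θw} ≤ K θ^α`
  have huniv : ∀ t : ℝ, ν {a | t < (X a)⁻¹ ^ s} ≤ ENNReal.ofReal (K * θ ^ α) := by
    intro t
    calc ν {a | t < (X a)⁻¹ ^ s} ≤ ν univ := measure_mono (subset_univ _)
      _ = μ {ω | X ω < θ * w} := by rw [hν, Measure.restrict_apply_univ]
      _ ≤ ENNReal.ofReal (K * (θ * w / w) ^ α) := hSB (θ * w) hc le_rfl
      _ = ENNReal.ofReal (K * θ ^ α) := by rw [mul_div_cancel_right₀ θ hw.ne']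
  -- the tail bound above the threshold: small ball at `τ = t^{-1/s}`
  have htail : ∀ t : ℝ, T < t →
      ν {a | t < (X a)⁻¹ ^ s} ≤ ENNReal.ofReal (K * (w ^ α)⁻¹ * t ^ (-(α / s))) := by
    intro t ht
    have ht0 : 0 < t := hT0.trans ht
    have hts : 0 < t ^ s⁻¹ := Real.rpow_pos_of_pos ht0 _
    have hτ0 : 0 < (t ^ s⁻¹)⁻¹ := inv_pos.2 hts
    have hτc : (t ^ s⁻¹)⁻¹ ≤ θ * w := by
      rw [inv_le_comm₀ hts hc]
      calc (θ * w)⁻¹ = T ^ s⁻¹ := by rw [hT, Real.rpow_rpow_inv (inv_pos.2 hc).le hs0]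
        _ ≤ t ^ s⁻¹ := Real.rpow_le_rpow hT0.le ht.le (inv_nonneg.2 hs.le)
    have hsub : {a | t < (X a)⁻¹ ^ s} ∩ {ω | X ω < θ * w} ⊆ {ω | X ω < (t ^ s⁻¹)⁻¹} := by
      intro ω hω
      have hω : t < (X ω)⁻¹ ^ s := hω.1
      show X ω < (t ^ s⁻¹)⁻¹
      by_contra hge
      have hge : (t ^ s⁻¹)⁻¹ ≤ X ω := not_lt.1 hge
      have hXpos : 0 < X ω := hτ0.trans_le hge
      have h1 : (X ω)⁻¹ ≤ t ^ s⁻¹ := (inv_le_comm₀ hXpos hts).2 hge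
      have h2 : (X ω)⁻¹ ^ s ≤ (t ^ s⁻¹) ^ s := Real.rpow_le_rpow (inv_nonneg.2 hXpos.le) h1 hs.le
      rw [Real.rpow_inv_rpow ht0.le hs0] at h2
      exact absurd hω (not_lt.2 h2)
    calc ν {a | t < (X a)⁻¹ ^ s} = μ ({a | t < (X a)⁻¹ ^ s} ∩ {ω | X ω < θ * w}) := by
          rw [hν, Measure.restrict_apply (measurableSet_lt measurable_const hfm)]
      _ ≤ μ {ω | X ω < (t ^ s⁻¹)⁻¹} := measure_mono hsub
      _ ≤ ENNReal.ofReal (K * ((t ^ s⁻¹)⁻¹ / w) ^ α) := hSB _ hτ0 hτc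
      _ = ENNReal.ofReal (K * (w ^ α)⁻¹ * t ^ (-(α / s))) := by
          congr 1
          rw [Real.div_rpow hτ0.le hw.le, Real.inv_rpow hts.le, ← Real.rpow_mul ht0.le,
            inv_mul_eq_div, Real.rpow_neg ht0.le]
          ring
  -- split the level integral at `T`
  rw [← Ioc_union_Ioi_eq_Ioi hT0.le]
  refine (lintegral_union_le _ _ _).trans ?_
  have hp1 : ∫⁻ t in Ioc 0 T, ν {a | t < (X a)⁻¹ ^ s} ≤ ENNReal.ofReal (K * θ ^ α * T) :=
    calc ∫⁻ t in Ioc 0 T, ν {a | t < (X a)⁻¹ ^ s} ≤ ∫⁻ _ in Ioc 0 T, ENNReal.ofReal (K * θ ^ α) :=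
          lintegral_mono fun t => huniv t
      _ = ENNReal.ofReal (K * θ ^ α * T) := by
          rw [setLIntegral_const, Real.volume_Ioc, sub_zero, ← ENNReal.ofReal_mul (by positivity)]
  have hexp : -(α / s) < -1 := by
    rw [neg_lt_neg_iff, one_lt_div hs]
    exact hsα
  have hint : IntegrableOn (fun t : ℝ => K * (w ^ α)⁻¹ * t ^ (-(α / s))) (Ioi T) :=
    (integrableOn_Ioi_rpow_of_lt hexp hT0).const_mul _
  -- `T^{1 - α/s} = T (θw)^α`
  have hTpow : T ^ (-(α / s) + 1) = T * (θ ^ α * w ^ α) := by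
    have he1 : s * (-(α / s) + 1) = s - α := by
      field_simp
      ring
    rw [hT, ← Real.rpow_mul (inv_pos.2 hc).le, he1, Real.rpow_sub (inv_pos.2 hc),
      Real.inv_rpow hc.le α, Real.mul_rpow hθ.le hw.le, div_inv_eq_mul]
  have hp2 : ∫⁻ t in Ioi T, ν {a | t < (X a)⁻¹ ^ s} ≤
      ENNReal.ofReal (K * θ ^ α * T * (s / (α - s))) :=
    calc ∫⁻ t in Ioi T, ν {a | t < (X a)⁻¹ ^ s}
        ≤ ∫⁻ t in Ioi T, ENNReal.ofReal (K * (w ^ α)⁻¹ * t ^ (-(α / s))) :=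
          setLIntegral_mono' measurableSet_Ioi fun t ht => htail t ht
      _ = ENNReal.ofReal (∫ t in Ioi T, K * (w ^ α)⁻¹ * t ^ (-(α / s))) :=
          (ofReal_integral_eq_lintegral_ofReal hint ((ae_restrict_mem measurableSet_Ioi).mono
            fun t ht => by
              have ht' : 0 < t := hT0.trans ht
              positivity)).symm
      _ = ENNReal.ofReal (K * θ ^ α * T * (s / (α - s))) := by
          congr 1
          have hαs0 : α - s ≠ 0 := hαs.ne'
          have hwα : w ^ α ≠ 0 := (Real.rpow_pos_of_pos hw α).ne'
          have he2 : -(α / s) + 1 = -((α - s) / s) := by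
            field_simp
            ring
          rw [integral_const_mul, integral_Ioi_rpow_of_lt hexp hT0, hTpow, he2]
          field_simp
  calc (∫⁻ t in Ioc 0 T, ν {a | t < (X a)⁻¹ ^ s}) + ∫⁻ t in Ioi T, ν {a | t < (X a)⁻¹ ^ s}
      ≤ ENNReal.ofReal (K * θ ^ α * T) + ENNReal.ofReal (K * θ ^ α * T * (s / (α - s))) :=
        add_le_add hp1 hp2
    _ = ENNReal.ofReal (K * θ ^ α * (α / (α - s)) * T) := by
        have hαs0 : α - s ≠ 0 := hαs.ne'
        rw [← ENNReal.ofReal_add (by positivity) (by positivity)]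
        congr 1
        field_simp
        ring

end Summit.QuantumFields.QCD.Cruxes.ExtinctionBuildsQCD.DeterminantTilt

end
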